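import Literature.AlgebraicGeometry.Resolution.RsopMonomialIdeals
import HarnessLib

/-!
# Crux `PatchingRelPerfect` (stmt-ResolutionOfSingularities-16161), chain W5.2 — F7(β) (β-AX) X3, LEMMA E (local-algebra half):
# a regular parameter `g` and a family `z` form part of a regular system of parameters of `R`
# iff the images `z̄` form part of a regular system of parameters of the CARRIER `R ⧸ (g)`

[OURS · L1 W5.2 · F7(β) (β-AX) X3 `PhaseCTermination₂` · res-L1-w52-idea-1 X3 MEASURE MEMO inst. 1 §1 LEMMA E «END read on the
carrier: `g` plus lifts of part of an r.s.o.p. of `𝒪_{G,x} = 𝒪_{X,x}/g` is part of an r.s.o.p. of `𝒪_{X,x}`; ⇒: restrict» ·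
res-L1-w52-plan-1 QUESTION Q13 / RULING G11-14 (1) «END at y ⟺ the members and ALL hosts through y form ONE snc system of regular
parameters»] res-L1-w52-stub-1 g5.  Replaces the role of NO printed item; NOT a statement of the manuscript under review (AI-written,
weaker than expert review).  Pure commutative algebra in the `IsRsopPart` currency of `Literature/…/RsopMonomialIdeals.lean`:

* `IsRsopPart.cons_of_quotient` — `R` regular local, `g ≠ 0`, `z : Fin n → R`; if the images `z̄ᵢ` in `R ⧸ (g)` are part of a
  regular system of parameters (in particular `R ⧸ (g)` is regular, i.e. `g ∉ 𝔪²`), then `(g, z₁, …, z_n)` is part of a regular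
  system of parameters of `R`;
* `IsRsopPart.quotient_of_cons` — conversely, if `(g, z₁, …, z_n)` is part of a regular system of parameters of `R`, the images
  `z̄ᵢ` are part of a regular system of parameters of `R ⧸ (g)`;
* `isRsopPart_cons_iff` — the equivalence (for `R` regular local, `g ≠ 0`).

Proof: Matsumura 14.2 in the tree's packaging (`IsRsopPart.of_isRegularLocalRing_quotient`, `.isRegularLocalRing_quotient`,
`.ringKrullDim_quotient_add`) through the iterated-quotient isomorphism `(R ⧸ (g)) ⧸ (z̄) ≅ R ⧸ (g, z)` (`DoubleQuot.quotQuotEquivQuotSup`)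
and `dim R ⧸ (g) + 1 = dim R` (`ringKrullDim_quotient_span_singleton_succ_eq_ringKrullDim`).  This is the stalk-level content of
X3's Lemma E (format-snc END at a point of the carrier `G = V(g)` ⟺ the traces of the other format divisors are part of ONE regular system
of parameters of `𝒪_{G,x}`); the `HasSNC`/`SNCWithAt` wrapper is the X3 typer's.  Fact-free.

## References
* H. Matsumura, *Commutative Ring Theory*, CUP 1986, Thm. 14.2, Thm. 14.3. [Matsumura1987]
* The Stacks Project, Tag 00NQ (regular local rings and regular sequences). [StacksProject]
-/

-- `Summit.<Summit>.<Sub>.Theorems` with `Sub = Summit` (single-conjunct summit, D-0017)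
set_option linter.dupNamespace false

noncomputable section

open IsLocalRing

namespace Literature.AlgebraicGeometry.Resolution

universe u

variable {R : Type u} [CommRing R]

/-! ## §0 The iterated quotient `(R ⧸ (g)) ⧸ (z̄) ≅ R ⧸ (g, z)` -/

/-- `(g, z₁, …, z_n) = (g) + (z₁, …, z_n)` as ideals. [folklore] -/
theorem span_range_cons_eq_sup (g : R) {n : ℕ} (z : Fin n → R) :
    Ideal.span (Set.range (Fin.cons g z : Fin (n + 1) → R)) = Ideal.span {g} ⊔ Ideal.span (Set.range z) := by
  rw [Fin.range_cons, Ideal.span_insert]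

/-- The image of `(z₁, …, z_n)` in a quotient is generated by the images. [folklore] -/
theorem map_mk_span_range (I : Ideal R) {n : ℕ} (z : Fin n → R) :
    (Ideal.span (Set.range z)).map (Ideal.Quotient.mk I) = Ideal.span (Set.range fun i => Ideal.Quotient.mk I (z i)) := by
  rw [Ideal.map_span, ← Set.range_comp]
  rfl

/-- **The iterated quotient**: `(R ⧸ (g)) ⧸ (z̄₁, …, z̄_n) ≅ R ⧸ (g, z₁, …, z_n)`. [folklore] -/
theorem nonempty_quotQuot_ringEquiv (g : R) {n : ℕ} (z : Fin n → R) :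
    Nonempty (((R ⧸ Ideal.span {g}) ⧸ Ideal.span (Set.range fun i => Ideal.Quotient.mk (Ideal.span {g}) (z i))) ≃+*
      R ⧸ Ideal.span (Set.range (Fin.cons g z : Fin (n + 1) → R))) :=
  ⟨(Ideal.quotEquivOfEq (map_mk_span_range (Ideal.span {g}) z).symm).trans
    ((DoubleQuot.quotQuotEquivQuotSup (Ideal.span {g}) (Ideal.span (Set.range z))).trans
      (Ideal.quotEquivOfEq (span_range_cons_eq_sup g z).symm))⟩

/-! ## §1 Dimension bookkeeping -/

/-- In a regular local ring, `dim R ⧸ (g) + 1 = dim R` for `g ≠ 0` in `𝔪`. [cite: Matsumura1987, Thm. 14.2] -/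
theorem ringKrullDim_quotient_span_singleton_add_one [IsRegularLocalRing R] {g : R} (hg : g ∈ maximalIdeal R)
    (hg0 : g ≠ 0) : ringKrullDim (R ⧸ Ideal.span {g}) + 1 = ringKrullDim R := by
  haveI : IsDomain R := isDomain_of_isRegularLocalRing R
  exact ringKrullDim_quotient_span_singleton_succ_eq_ringKrullDim_of_mem_nonZeroDivisors
    (mem_nonZeroDivisors_of_ne_zero hg0) hg

/-! ## §2 Lemma E, local-algebra half -/

section LemmaE

variable [IsRegularLocalRing R] {g : R} {n : ℕ} {z : Fin n → R}

/-- [OURS · L1 W5.2 · X3 Lemma E (⇐)] **Lifting from the carrier.** `R` regular local, `g ≠ 0`; if the images `z̄ᵢ ∈ R ⧸ (g)` are part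
of a regular system of parameters of `R ⧸ (g)`, then `(g, z₁, …, z_n)` is part of a regular system of parameters of `R`.
[cite: Matsumura1987, Thm. 14.2] -/
theorem IsRsopPart.cons_of_quotient [IsLocalRing (R ⧸ Ideal.span {g})] (hg0 : g ≠ 0)
    (hz : IsRsopPart fun i => Ideal.Quotient.mk (Ideal.span {g}) (z i)) :
    IsRsopPart (Fin.cons g z : Fin (n + 1) → R) := by
  obtain ⟨e⟩ := nonempty_quotQuot_ringEquiv g z
  -- `g ∈ 𝔪`: otherwise `R ⧸ (g)` is trivial, but it is a local ring
  have hg : g ∈ maximalIdeal R := by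
    by_contra hu
    have hunit : IsUnit g := not_not.mp fun h' => hu ((IsLocalRing.mem_maximalIdeal g).mpr h')
    have htop : Ideal.span {g} = ⊤ := Ideal.span_singleton_eq_top.mpr hunit
    have : Subsingleton (R ⧸ Ideal.span {g}) := Ideal.Quotient.subsingleton_iff.mpr htop
    exact false_of_nontrivial_of_subsingleton (R ⧸ Ideal.span {g})
  -- members in `𝔪`
  have hzm : ∀ i, (Fin.cons g z : Fin (n + 1) → R) i ∈ maximalIdeal R := by
    intro i
    induction i using Fin.cases with
    | zero => exact hg
    | succ j =>
      rw [Fin.cons_succ]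
      by_contra hu
      have hunit : IsUnit (z j) := not_not.mp fun h' => hu ((IsLocalRing.mem_maximalIdeal (z j)).mpr h')
      exact (IsLocalRing.mem_maximalIdeal _).mp (hz.mem_maximalIdeal j) (hunit.map _)
  -- regularity of `R ⧸ (g, z)`
  haveI hreg : IsRegularLocalRing (R ⧸ Ideal.span (Set.range (Fin.cons g z : Fin (n + 1) → R))) :=
    haveI := hz.isRegularLocalRing_quotient
    IsRegularLocalRing.of_ringEquiv e
  -- dimension count
  refine IsRsopPart.of_isRegularLocalRing_quotient hzm ?_
  have hdz := hz.ringKrullDim_quotient_add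
  have hdg := ringKrullDim_quotient_span_singleton_add_one hg hg0
  rw [← ringKrullDim_eq_of_ringEquiv e, ← hdg, ← hdz, Nat.cast_add, Nat.cast_one, add_assoc]

/-- [OURS · L1 W5.2 · X3 Lemma E (⇒)] **Restricting to the carrier.** If `(g, z₁, …, z_n)` is part of a regular system of parameters of
the regular local ring `R`, then the images `z̄ᵢ` are part of a regular system of parameters of `R ⧸ (g)`. [cite: Matsumura1987, Thm. 14.2] -/
theorem IsRsopPart.quotient_of_cons [IsLocalRing (R ⧸ Ideal.span {g})] (h : IsRsopPart (Fin.cons g z : Fin (n + 1) → R)) :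
    IsRsopPart fun i => Ideal.Quotient.mk (Ideal.span {g}) (z i) := by
  obtain ⟨e⟩ := nonempty_quotQuot_ringEquiv g z
  have hg : g ∈ maximalIdeal R := by simpa using h.mem_maximalIdeal 0
  have hg0 : g ≠ 0 := by simpa using h.ne_zero 0
  haveI : IsLocalHom (Ideal.Quotient.mk (Ideal.span {g})) := IsLocalHom.of_surjective _ Ideal.Quotient.mk_surjective
  have hzm : ∀ i, Ideal.Quotient.mk (Ideal.span {g}) (z i) ∈ maximalIdeal (R ⧸ Ideal.span {g}) := by
    intro i
    have hzi : z i ∈ maximalIdeal R := by simpa using h.mem_maximalIdeal i.succ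
    exact map_nonunit (Ideal.Quotient.mk (Ideal.span {g})) (z i) hzi
  haveI hreg' := h.isRegularLocalRing_quotient
  haveI hreg : IsRegularLocalRing
      ((R ⧸ Ideal.span {g}) ⧸ Ideal.span (Set.range fun i => Ideal.Quotient.mk (Ideal.span {g}) (z i))) :=
    IsRegularLocalRing.of_ringEquiv e.symm
  haveI : IsNoetherianRing (R ⧸ Ideal.span {g}) := inferInstance
  refine IsRsopPart.of_isRegularLocalRing_quotient hzm (le_of_eq ?_)
  have hdz := h.ringKrullDim_quotient_add
  have hdg := ringKrullDim_quotient_span_singleton_add_one hg hg0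
  -- all dimensions are natural numbers
  obtain ⟨a, ha⟩ := exists_nat_cast_eq_ringKrullDim (R := R ⧸ Ideal.span (Set.range (Fin.cons g z : Fin (n + 1) → R)))
  obtain ⟨b, hb⟩ := exists_nat_cast_eq_ringKrullDim (R := R ⧸ Ideal.span {g})
  rw [ringKrullDim_eq_of_ringEquiv e, ha, hb]
  rw [ha, ← hdg, hb, Nat.cast_add, Nat.cast_one] at hdz
  have hab : a + (n + 1) = b + 1 := by exact_mod_cast hdz
  have : a + n = b := by omega
  exact_mod_cast this

/-- [OURS · L1 W5.2 · X3 Lemma E] **Lemma E, local-algebra half**: for `R` regular local and `g ≠ 0`, `(g, z)` is part of a regular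
system of parameters of `R` iff `z̄` is part of a regular system of parameters of the carrier ring `R ⧸ (g)`.
[cite: Matsumura1987, Thm. 14.2] -/
theorem isRsopPart_cons_iff [IsLocalRing (R ⧸ Ideal.span {g})] (hg0 : g ≠ 0) :
    IsRsopPart (Fin.cons g z : Fin (n + 1) → R) ↔ IsRsopPart fun i => Ideal.Quotient.mk (Ideal.span {g}) (z i) :=
  ⟨IsRsopPart.quotient_of_cons, IsRsopPart.cons_of_quotient hg0⟩

end LemmaE

end Literature.AlgebraicGeometry.Resolution

end
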